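import Literature.Computability.AlgebraicComplexity.GenericFormsNonsingular
import Literature.Computability.AlgebraicComplexity.BI17GenericBinaryCubicPeriod
import Literature.Computability.AlgebraicComplexity.BI17SmoothTernaryCubicPolystable
import Literature.AlgebraicGeometry.PlaneCurves.HesseCanonicalForm
import Mathlib.LinearAlgebra.Matrix.MvPolynomial
import HarnessLib

/-!
# Almost all ternary cubics have stabilizer period `≠ 1` — the `(3, 3)` row of BI 2017 Cor. 3.17 (2)
# is vacuous

Sibling proof file of `Literature/Computability/AlgebraicComplexity/BI17FundamentalInvariantForms.lean`
(cell `val-lit`, DAG row BI2017-A). Every smooth ternary cubic is `GL₃`-equivalent to a multiple of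
a Hesse form `H_μ = x³ + y³ + z³ − 3μxyz` (Artebani–Dolgachev Lemma 1, tree
`exists_bind₁_eq_smul_hesse_of_forall_regular`), and the coordinate swap `x ↔ y` (determinant `−1`)
stabilises every `H_μ`; so `−1 ∈ det(stab)` and the stabilizer period `a(w)` (BI Def. 2.2) of a
smooth cubic is not `1` (`stabilizerPeriod_ne_one_of_forall_regular`; in fact `a(3,3) = a'(3,3) = 2`,
App. Prop. 7.5 (1), not proved here). With val-lit-p4 g5's `isZariskiGeneric_forall_exists_eval_pderiv_ne_zero`
(almost all forms are nonsingular) and `IsZariskiGeneric.exists_form`: "almost all ternary cubics have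
`a'(w) = 1`" is FALSE (`not_isZariskiGeneric_reducedStabilizerPeriod_eq_one_three_three`), i.e. the
hypothesis of Cor. 3.17 (2) fails at `(D, m) = (3, 3)` — that instance of the corollary is vacuous
(bookkeeping companion of the `(2, m)` and `(3, 2)` guards). Everything PROVED; no definitions, no
facts; nothing here bears on `VP` versus `VNP`.
-/

noncomputable section

open MvPolynomial Matrix

namespace Literature.Computability.AlgebraicComplexity

/-- The tree's `linSubst A` is Mathlib's `bind₁ (Aᵀ).toMvPolynomial` (private copy, as in
`BI17SmoothTernaryCubicPolystable.lean`). [folklore] -/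
private theorem linSubst_eq_bind₁'' {k : Type*} [Field k] {m : ℕ} (A : Matrix (Fin m) (Fin m) k)
    (p : MvPolynomial (Fin m) k) :
    linSubst (Fin m) k A p = bind₁ A.transpose.toMvPolynomial p := by
  have h : linSubst (Fin m) k A = bind₁ A.transpose.toMvPolynomial := by
    apply MvPolynomial.algHom_ext
    intro i
    rw [linSubst_X, bind₁_X_right, Matrix.toMvPolynomial]
    refine Finset.sum_congr rfl fun j _ => ?_
    rw [Matrix.transpose_apply, smul_eq_C_mul, ← pow_one (X j), C_mul_X_pow_eq_monomial]
  rw [h]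

/-- Evaluating a substituted form: `(linSubst M f)(x) = f(Mᵀ x)` (private copy of the lemma of
`BI17QuadraticPeriodProofs.lean`). [folklore] -/
private theorem eval_linSubst₃ {m : ℕ} (M : Matrix (Fin m) (Fin m) ℂ) (x : Fin m → ℂ)
    (f : MvPolynomial (Fin m) ℂ) : eval x (linSubst (Fin m) ℂ M f) = eval (Mᵀ *ᵥ x) f := by
  induction f using MvPolynomial.induction_on with
  | C a => rw [linSubst_C, eval_C, eval_C]
  | add p q hp hq => rw [map_add, map_add, map_add, hp, hq]
  | mul_X p i hp =>
    rw [map_mul, map_mul, map_mul, hp, linSubst_X, eval_X]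
    congr 1
    simp [mulVec, dotProduct, smul_eval]

/-- The coordinate swap `x ↔ y` has determinant `−1`. [folklore] -/
private theorem det_swapXY : (!![0, 1, 0; 1, 0, 0; 0, 0, 1] : Matrix (Fin 3) (Fin 3) ℂ).det = -1 := by
  rw [Matrix.det_fin_three]
  simp

/-- The swap `x ↔ y` stabilises every Hesse form `x³ + y³ + z³ − 3μxyz`. [folklore] -/
private theorem linSubst_swapXY_hesse (μ : ℂ) :
    linSubst (Fin 3) ℂ (!![0, 1, 0; 1, 0, 0; 0, 0, 1] : Matrix (Fin 3) (Fin 3) ℂ)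
      (X 0 ^ 3 + X 1 ^ 3 + X 2 ^ 3 - C (3 * μ) * (X 0 * X 1 * X 2) : MvPolynomial (Fin 3) ℂ) =
      X 0 ^ 3 + X 1 ^ 3 + X 2 ^ 3 - C (3 * μ) * (X 0 * X 1 * X 2) := by
  apply MvPolynomial.funext
  intro x
  rw [eval_linSubst₃]
  simp [Matrix.mulVec, dotProduct, Fin.sum_univ_three]
  ring

/-- **Every Hesse form has stabilizer period `≠ 1`**: the swap `x ↔ y` stabilises
`x³ + y³ + z³ − 3μxyz` and has determinant `−1`, so `det(stab) ∋ −1` is not the trivial group.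
[cite: BurgisserIkenmeyer2017, Def. 2.2 and App. Prop. 7.5 (1)] -/
theorem stabilizerPeriod_hesse_ne_one (μ : ℂ) :
    stabilizerPeriod (X 0 ^ 3 + X 1 ^ 3 + X 2 ^ 3 - C (3 * μ) * (X 0 * X 1 * X 2) : MvPolynomial (Fin 3) ℂ) ≠ 1 := by
  intro h
  rw [stabilizerPeriod_def, Subgroup.card_eq_one] at h
  have hP : (!![0, 1, 0; 1, 0, 0; 0, 0, 1] : Matrix (Fin 3) (Fin 3) ℂ).det ≠ 0 := by rw [det_swapXY]; norm_num
  have hmem : Matrix.GeneralLinearGroup.det (Matrix.GeneralLinearGroup.mkOfDetNeZero (!![0, 1, 0; 1, 0, 0; 0, 0, 1] : Matrix (Fin 3) (Fin 3) ℂ) hP) ∈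
      stabilizerDetImage
        (X 0 ^ 3 + X 1 ^ 3 + X 2 ^ 3 - C (3 * μ) * (X 0 * X 1 * X 2) : MvPolynomial (Fin 3) ℂ) := by
    rw [mem_stabilizerDetImage_iff]
    refine ⟨_, ?_, rfl⟩
    show linSubstRep (Fin 3) ℂ (Matrix.GeneralLinearGroup.mkOfDetNeZero (!![0, 1, 0; 1, 0, 0; 0, 0, 1] : Matrix (Fin 3) (Fin 3) ℂ) hP) _ = _
    rw [linSubstRep_apply]
    exact linSubst_swapXY_hesse μ
  rw [h, Subgroup.mem_bot] at hmem
  have hval := congrArg (fun u : ℂˣ => (u : ℂ)) hmem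
  simp only [Matrix.GeneralLinearGroup.val_det_apply, Units.val_one] at hval
  rw [show ((Matrix.GeneralLinearGroup.mkOfDetNeZero (!![0, 1, 0; 1, 0, 0; 0, 0, 1] : Matrix (Fin 3) (Fin 3) ℂ) hP : GL (Fin 3) ℂ) :
      Matrix (Fin 3) (Fin 3) ℂ) = (!![0, 1, 0; 1, 0, 0; 0, 0, 1] : Matrix (Fin 3) (Fin 3) ℂ) from rfl, det_swapXY] at hval
  norm_num at hval

/-- **A smooth ternary cubic has stabilizer period `≠ 1`** (it is `GL₃`-equivalent to `c · H_μ`,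
Artebani–Dolgachev Lemma 1, and the period is a `GL`-orbit and scaling invariant).
[cite: BurgisserIkenmeyer2017, Def. 2.2 and App. Prop. 7.5 (1)] -/
theorem stabilizerPeriod_ne_one_of_forall_regular {F : MvPolynomial (Fin 3) ℂ} (hF : F.IsHomogeneous 3)
    (hreg : ∀ p : Fin 3 → ℂ, p ≠ 0 → eval p F = 0 → (fun i => eval p (pderiv i F)) ≠ 0) :
    stabilizerPeriod F ≠ 1 := by
  obtain ⟨μ, M, c, -, hM, hc, hFM⟩ :=
    Literature.AlgebraicGeometry.PlaneCurves.exists_bind₁_eq_smul_hesse_of_forall_regular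
      (K := ℂ) two_ne_zero three_ne_zero hF hreg
  have h' : linSubst (Fin 3) ℂ Mᵀ F =
      c • (X 0 ^ 3 + X 1 ^ 3 + X 2 ^ 3 - C (3 * μ) * (X 0 * X 1 * X 2) : MvPolynomial (Fin 3) ℂ) := by
    rw [linSubst_eq_bind₁'', Matrix.transpose_transpose]
    exact hFM
  have hMt : Mᵀ.det ≠ 0 := by rwa [Matrix.det_transpose]
  rw [← stabilizerPeriod_linSubst_of_det_ne_zero hMt F, h', stabilizerPeriod_smul hc]
  exact stabilizerPeriod_hesse_ne_one μ

/-- **The `(3, 3)` row of Cor. 3.17 (2) is vacuous**: "almost all ternary cubics have reduced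
stabilizer period `a'(w) = 1`" is false — almost all are smooth
(`isZariskiGeneric_forall_exists_eval_pderiv_ne_zero`), smooth ones have `a(w) ≠ 1`, and
`a'(w) = a(w) · gcd(3,3)/3 = a(w)`. [cite: BurgisserIkenmeyer2017, Cor. 3.17 (2) and App. Prop. 7.5 (1)] -/
theorem not_isZariskiGeneric_reducedStabilizerPeriod_eq_one_three_three :
    ¬ IsZariskiGeneric 3 (fun F : MvPolynomial (Fin 3) ℂ => reducedStabilizerPeriod 3 F = 1) := by
  intro h
  have hgen := isZariskiGeneric_forall_exists_eval_pderiv_ne_zero (n := 1) (D := 3) (by norm_num)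
  obtain ⟨F, hF, h1, h2⟩ := IsZariskiGeneric.exists_form (h.and hgen)
  have hreg : ∀ p : Fin 3 → ℂ, p ≠ 0 → eval p F = 0 → (fun i => eval p (pderiv i F)) ≠ 0 := by
    intro p hp hFp hgrad
    obtain ⟨j, hj⟩ := h2 p hp hFp
    exact hj (congr_fun hgrad j)
  refine stabilizerPeriod_ne_one_of_forall_regular hF hreg ?_
  rw [reducedStabilizerPeriod, Fintype.card_fin, Nat.gcd_self,
    Nat.mul_div_cancel _ (by norm_num : 0 < 3)] at h1
  exact h1

end Literature.Computability.AlgebraicComplexity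

end
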